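import Mathlib.AlgebraicGeometry.Morphisms.Etale
import Mathlib.RingTheory.Localization.LocalizationLocalization
import Mathlib.RingTheory.RegularLocalRing.Defs
import HarnessLib

/-!
# Crux `FrobeniusLadder.FRationalResolution` (stmt-ResolutionOfSingularities-15317), line `redirect`,
# stub `stub_diagonalizableQuotientResolution` — **shrinking an étale roof to a basic open of the chart ring**
# (design C3 = the rank-2 stratum layer of the non-isolated case, scheme-level global round L3-b: the ring-level
# description of the singular locus of a cone chart algebra and the radicality of the chain ideal hold on a basic open
# neighbourhood `D(g)` of the fixed prime only (`…FixedStratumRadicalNearby`), so the roof `X ←ρ— Y —j↪ Spec C` is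
# replaced by `X ←— j⁻¹(D(g)) —↪ Spec C_g` before `…SingBlowupRoofPullback.exists_roof_pullback` is applied)

* `exists_roof_shrink` — for an étale roof `X ←ρ— Y —j↪ Spec R`, `g ∈ R` and a point `y` with `g ∉ j y`: the open
  `Y' = j⁻¹(D(g))` is an étale roof `X ←ρ'— Y' —j'↪ Spec R_g` through `y`, `j'` lifting `j` (`IsOpenImmersion.lift`),
  with `(j' y'') ∩ R = j(ι y'')` for every point;
* `isRegularLocalRing_atPrime_localization_iff`, `map_le_iff_le_comap_of_localization` — the dictionary
  `(R_g)_{𝔔'} ≅ R_{𝔔' ∩ R}` (regularity) and `J R_g ⊆ 𝔔' ↔ J ⊆ 𝔔' ∩ R` that transports a pointwise description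
  «`¬ regular ↔ J ⊆ ·`» of the singular locus from `Spec R` to `Spec R_g`.

Honest label: scheme plumbing toward ONE leaf stub (no stub, crux or summit closed). No definitions, no named facts,
no sorry. [cite: GortzWedhorn2020, Prop. 13.91] [folklore]
-/

noncomputable section

-- single-problem summit: the doubled namespace component is forced
set_option linter.dupNamespace false

open CategoryTheory AlgebraicGeometry TopologicalSpace

namespace Summit.ResolutionOfSingularities.ResolutionOfSingularities.Theorems.FRationalResolution.RoofShrink

/-- **Shrinking an étale roof to a basic open.** [cite: GortzWedhorn2020, Prop. 13.91] [folklore] -/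
theorem exists_roof_shrink {X Y : Scheme.{0}} (ρ : Y ⟶ X) [Etale ρ] {R : Type} [CommRing R]
    (j : Y ⟶ Spec (.of R)) [IsOpenImmersion j] (g : R) (y : Y) (hg : g ∉ (j y).asIdeal) :
    ∃ (Y' : Scheme.{0}) (ρ' : Y' ⟶ X) (_ : Etale ρ') (j' : Y' ⟶ Spec (.of (Localization.Away g)))
      (_ : IsOpenImmersion j') (ι : Y' ⟶ Y) (_ : IsOpenImmersion ι) (y' : Y'),
      ρ' = ι ≫ ρ ∧ j' ≫ Spec.map (CommRingCat.ofHom (algebraMap R (Localization.Away g))) = ι ≫ j ∧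
      ι y' = y ∧
      ∀ y'' : Y', ((j' y'').asIdeal).comap (algebraMap R (Localization.Away g)) = (j (ι y'')).asIdeal := by
  set l : Spec (.of (Localization.Away g)) ⟶ Spec (.of R) :=
    Spec.map (CommRingCat.ofHom (algebraMap R (Localization.Away g))) with hl
  have hrangeL : Set.range l = (PrimeSpectrum.basicOpen g : Set (PrimeSpectrum R)) := by
    have h := Scheme.Hom.opensRange_localizationAway (R := .of R) g
    rw [← h]
    rfl
  let U : Y.Opens := j ⁻¹ᵁ (PrimeSpectrum.basicOpen g)
  have hyU : y ∈ U := by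
    show j y ∈ PrimeSpectrum.basicOpen g
    exact (PrimeSpectrum.mem_basicOpen _ _).mpr hg
  have hrange : Set.range (U.ι ≫ j) ⊆ Set.range l := by
    rintro _ ⟨w, rfl⟩
    rw [hrangeL, Scheme.Hom.comp_apply]
    exact w.2
  have hfac := IsOpenImmersion.lift_fac l (U.ι ≫ j) hrange
  haveI : IsOpenImmersion (IsOpenImmersion.lift l (U.ι ≫ j) hrange) := by
    have : IsOpenImmersion (IsOpenImmersion.lift l (U.ι ≫ j) hrange ≫ l) := by
      rw [hfac]; infer_instance
    exact IsOpenImmersion.of_comp _ l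
  refine ⟨U, U.ι ≫ ρ, inferInstance, IsOpenImmersion.lift l (U.ι ≫ j) hrange, inferInstance, U.ι, inferInstance,
    ⟨y, hyU⟩, rfl, hfac, rfl, fun y'' => ?_⟩
  have h1 : l (IsOpenImmersion.lift l (U.ι ≫ j) hrange y'') = j (U.ι y'') := by
    rw [← Scheme.Hom.comp_apply, hfac, Scheme.Hom.comp_apply]
  rw [← h1]
  rfl

/-- `(R_g)_{𝔔'}` is regular iff `R_{𝔔' ∩ R}` is (both are the localization of `R` at `𝔔' ∩ R`). [folklore] -/
theorem isRegularLocalRing_atPrime_localization_iff {R : Type} [CommRing R] (g : R)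
    (𝔔' : Ideal (Localization.Away g)) [𝔔'.IsPrime] :
    IsRegularLocalRing (Localization.AtPrime 𝔔') ↔
      IsRegularLocalRing (Localization.AtPrime (𝔔'.comap (algebraMap R (Localization.Away g)))) := by
  let e := (IsLocalization.localizationLocalizationAtPrimeIsoLocalization (Submonoid.powers g) 𝔔').toRingEquiv
  exact ⟨fun _ => IsRegularLocalRing.of_ringEquiv e.symm, fun _ => IsRegularLocalRing.of_ringEquiv e⟩

/-- `J R_g ⊆ 𝔔'` iff `J ⊆ 𝔔' ∩ R`. [folklore] -/
theorem map_le_iff_le_comap_of_localization {R : Type} [CommRing R] (g : R) (J : Ideal R)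
    (𝔔' : Ideal (Localization.Away g)) :
    J.map (algebraMap R (Localization.Away g)) ≤ 𝔔' ↔ J ≤ 𝔔'.comap (algebraMap R (Localization.Away g)) :=
  Ideal.map_le_iff_le_comap

/-- **Transport of the pointwise description of the singular locus to the basic open**: if on the image of `Y'` in
`Spec R` one has `¬ regular R_𝔔 ↔ J ⊆ 𝔔`, then on the image of `Y'` in `Spec R_g` one has
`¬ regular (R_g)_{𝔔'} ↔ J R_g ⊆ 𝔔'`. [folklore] -/
theorem singular_iff_le_of_shrink {Y' : Scheme.{0}} {R : Type} [CommRing R] (g : R) (J : Ideal R)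
    (j' : Y' ⟶ Spec (.of (Localization.Away g)))
    (hZ : ∀ y'' : Y', ¬ IsRegularLocalRing (Localization.AtPrime
        (((j' y'').asIdeal).comap (algebraMap R (Localization.Away g)))) ↔
      J ≤ ((j' y'').asIdeal).comap (algebraMap R (Localization.Away g))) :
    ∀ y'' : Y', ¬ IsRegularLocalRing (Localization.AtPrime (j' y'').asIdeal) ↔
      J.map (algebraMap R (Localization.Away g)) ≤ (j' y'').asIdeal := by
  intro y''
  rw [isRegularLocalRing_atPrime_localization_iff g (j' y'').asIdeal, hZ y'', map_le_iff_le_comap_of_localization]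

end Summit.ResolutionOfSingularities.ResolutionOfSingularities.Theorems.FRationalResolution.RoofShrink

end
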